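import Mathlib
import Literature.RepresentationTheory.FiniteGroups.KLRGradedCellularBasis
import Summits.MatrixMultiplication.MatrixMultiplication.Theorems.SnSubsetDichotomyNoThresholdSubsetTriplePairSum

/-!
# Closed form of the Brundan–Kleshchev–Wang `2`-degree: odd-column cells minus signed south-west pairs

Stub `deg_eq_oddCols_sub_swPairs` of line `klr-graded-polynomial-method` (crux
`SnSubsetDichotomy.NoThresholdSubsetTriple`, stmt-MatrixMultiplication-8302).

For a standard Young tableau `T` of shape `μ ⊢ n` whose entry `k` sits in the cell
`T.1 k = (r_k, c_k)`, with sign `π_k = (-1)^(r_k + c_k)`: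

  `deg₂ T = #{cells of μ in odd columns} − 2 · Σ_{j < k, cell of j strictly south-west of cell of k} π_j π_k`.

Proof.  Start from the pair-sum formula `two_mul_tableauDegree_eq_pairSum`:
`2 · deg₂ T = Σ_k ([u_k > 0] π_k − Σ_{j < k} κ(u_k − u_j) π_j π_k)`, `u = col − row`,
`κ = 4 / 3 / 1 / 0` on content gaps `≥ 2 / = 1 / = 0 / < 0`.  For `j < k` the cell `x` of `j` is never
weakly south-east of the cell `y` of `k` (standardness), so either `x ≤ y` (weakly north-west; since `μ`
is a lower set filled increasingly, these `x` are exactly the cells `≠ y` of the rectangle spanned by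
`y`, `swPairs_sum_nw`), or `x` is strictly south-west of `y` (gap `≥ 2`, `κ = 4`), or strictly
north-east (gap `≤ -2`, `κ = 0`).  The rectangle contribution depends on `y = (r, c)` alone and is
`1 + [r < c] (-1)^(r+c) − 2 [c odd]` (`swPairs_rect`: reflect `(p, q) ↦ (r - p, c - q)`, then sum
column by column, `swPairs_colSum`, and row by row, `swPairs_rowSum`).  Finally `Σ_k 2 [c_k odd]`
counts the odd-column cells of `μ` twice, `T` being a bijection onto the cells (`swPairs_oddCount`).
-/

namespace Summit.MatrixMultiplication.MatrixMultiplication.Theorems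

open Literature.RepresentationTheory.FiniteGroups (tableauDegree)
open Literature.NumberTheory.DiophantineGeometry (StdFilling)

/-- Column sums of the reflected rectangle: for the weight `κ = 4 / 3 / 1 / 0` (on `≥ 2 / 1 / 0 / < 0`),
`Σ_{b ≤ c} κ(b − a) (−1)^(a + b)` is `0`, `1`, `2 (−1)^(a + c)` according as `c < a`, `c = a`, `c > a`.
[folklore] -/
private theorem swPairs_colSum (κ : ℤ → ℤ) (h2 : ∀ d, 2 ≤ d → κ d = 4) (h1 : κ 1 = 3)
    (h0 : κ 0 = 1) (hn : ∀ d, d < 0 → κ d = 0) (a : ℕ) : ∀ c : ℕ,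
    ∑ b ∈ Finset.range (c + 1), κ ((b : ℤ) - a) * (-1 : ℤ) ^ (a + b) =
      if c < a then 0 else if c = a then 1 else 2 * (-1 : ℤ) ^ (a + c) := by
  -- the four values of `κ` as one rewrite rule
  have hκ : ∀ d : ℤ, κ d = if d < 0 then 0 else if d = 0 then 1 else if d = 1 then 3 else 4 := by
    intro d
    split_ifs with hd hd0 hd1
    · exact hn d hd
    · rw [hd0, h0]
    · rw [hd1, h1]
    · exact h2 d (by omega)
  intro c
  induction c with
  | zero =>
    simp only [zero_add, Finset.sum_range_one, add_zero, Nat.cast_zero, zero_sub]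
    rw [hκ]
    rcases Nat.even_or_odd a with ha | ha
    · have ha' := Nat.even_iff.1 ha
      rw [ha.neg_one_pow]
      split_ifs <;> omega
    · have ha' := Nat.odd_iff.1 ha
      rw [ha.neg_one_pow]
      split_ifs <;> omega
  | succ c ih =>
    rw [Finset.sum_range_succ, ih, show a + (c + 1) = a + c + 1 from (add_assoc _ _ _).symm,
      pow_succ, hκ]
    rcases Nat.even_or_odd (a + c) with hs | hs
    · have hs' := Nat.even_iff.1 hs
      rw [hs.neg_one_pow]
      split_ifs <;> omega
    · have hs' := Nat.odd_iff.1 hs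
      rw [hs.neg_one_pow]
      split_ifs <;> omega

/-- Row-by-row summation of the column sums `swPairs_colSum`: the reflected rectangle sum in closed
form, `1 + [r < c] (−1)^(r + c) − 2 [c odd]`. [folklore] -/
private theorem swPairs_rowSum (c : ℕ) : ∀ r : ℕ,
    ∑ a ∈ Finset.range (r + 1),
        (if c < a then (0 : ℤ) else if c = a then 1 else 2 * (-1 : ℤ) ^ (a + c)) =
      1 + (if (0 : ℤ) < (c : ℤ) - r then (-1 : ℤ) ^ (r + c) else 0) -
        (if c % 2 = 1 then 2 else 0) := by
  intro r
  induction r with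
  | zero =>
    simp only [zero_add, Finset.sum_range_one, Nat.cast_zero, sub_zero]
    rcases Nat.even_or_odd c with hc | hc
    · have hc' := Nat.even_iff.1 hc
      rw [hc.neg_one_pow]
      split_ifs <;> omega
    · have hc' := Nat.odd_iff.1 hc
      rw [hc.neg_one_pow]
      split_ifs <;> omega
  | succ r ih =>
    rw [Finset.sum_range_succ, ih, show r + 1 + c = r + c + 1 by ring, pow_succ]
    rcases Nat.even_or_odd (r + c) with hs | hs
    · have hs' := Nat.even_iff.1 hs
      rw [hs.neg_one_pow]
      split_ifs <;> omega
    · have hs' := Nat.odd_iff.1 hs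
      rw [hs.neg_one_pow]
      split_ifs <;> omega

/-- Reflection `(p, q) ↦ (r − p, c − q)` of the rectangle `[0, r] × [0, c]`: the weight of a cell
against the corner `(r, c)` becomes a function of the reflected cell alone. [folklore] -/
private theorem swPairs_reflect (κ : ℤ → ℤ) (r c : ℕ) :
    ∑ x ∈ Finset.range (r + 1) ×ˢ Finset.range (c + 1),
        κ (((c : ℤ) - r) - ((x.2 : ℤ) - x.1)) * (-1 : ℤ) ^ (x.1 + x.2 + r + c) =
      ∑ a ∈ Finset.range (r + 1), ∑ b ∈ Finset.range (c + 1),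
        κ ((b : ℤ) - a) * (-1 : ℤ) ^ (a + b) := by
  rw [← Finset.sum_product']
  refine Finset.sum_nbij' (fun x => (r - x.1, c - x.2)) (fun x => (r - x.1, c - x.2)) ?_ ?_ ?_ ?_ ?_
  · intro x hx
    simp only [Finset.mem_product, Finset.mem_range] at hx ⊢
    omega
  · intro x hx
    simp only [Finset.mem_product, Finset.mem_range] at hx ⊢
    omega
  · intro x hx
    simp only [Finset.mem_product, Finset.mem_range] at hx
    obtain ⟨a, b⟩ := x
    simp only [Prod.mk.injEq]
    omega
  · intro x hx
    simp only [Finset.mem_product, Finset.mem_range] at hx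
    obtain ⟨a, b⟩ := x
    simp only [Prod.mk.injEq]
    omega
  · intro x hx
    simp only [Finset.mem_product, Finset.mem_range] at hx
    obtain ⟨p, q⟩ := x
    dsimp only
    have hs : (-1 : ℤ) ^ (p + q + r + c) = (-1 : ℤ) ^ (r - p + (c - q)) := by
      rw [show p + q + r + c = (r - p + (c - q)) + 2 * (p + q) by omega, pow_add, pow_mul]
      norm_num
    rw [hs, Nat.cast_sub (by omega : p ≤ r), Nat.cast_sub (by omega : q ≤ c)]
    congr 2
    ring

/-- **The rectangle identity.** For the corner `(r, c)`:
`Σ_{p ≤ r, q ≤ c} κ((c − r) − (q − p)) (−1)^(p + q + r + c) = 1 + [r < c] (−1)^(r + c) − 2 [c odd]`.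
[folklore] -/
private theorem swPairs_rect (κ : ℤ → ℤ) (h2 : ∀ d, 2 ≤ d → κ d = 4) (h1 : κ 1 = 3)
    (h0 : κ 0 = 1) (hn : ∀ d, d < 0 → κ d = 0) (r c : ℕ) :
    ∑ x ∈ Finset.range (r + 1) ×ˢ Finset.range (c + 1),
        κ (((c : ℤ) - r) - ((x.2 : ℤ) - x.1)) * (-1 : ℤ) ^ (x.1 + x.2 + r + c) =
      1 + (if (0 : ℤ) < (c : ℤ) - r then (-1 : ℤ) ^ (r + c) else 0) -
        (if c % 2 = 1 then 2 else 0) := by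
  rw [swPairs_reflect κ r c, ← swPairs_rowSum c r]
  exact Finset.sum_congr rfl fun a _ => swPairs_colSum κ h2 h1 h0 hn a c

/-- For `j < k`, the entries `j` whose cell is weakly north-west of the cell `y` of `k` occupy exactly
the cells `≠ y` of the rectangle spanned by `y` (the diagram is a lower set, the filling is increasing
and bijective): re-indexing of the corresponding sums. [folklore] -/
private theorem swPairs_sum_nw {n : ℕ} {μ : Nat.Partition n} (T : StdFilling n μ.youngDiagram)
    (k : Fin n) (F : ℕ × ℕ → ℤ) :
    ∑ j ∈ Finset.univ.filter (fun j : Fin n => j < k ∧ T.1 j ≤ T.1 k), F (T.1 j) =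
      ∑ x ∈ (Finset.range ((T.1 k).1 + 1) ×ˢ Finset.range ((T.1 k).2 + 1)).erase (T.1 k), F x := by
  refine Finset.sum_nbij T.1 ?_ T.injective.injOn ?_ (fun _ _ => rfl)
  · intro j hj
    obtain ⟨hjk, hle⟩ := (Finset.mem_filter.1 hj).2
    rw [Prod.le_def] at hle
    rw [Finset.mem_erase, Finset.mem_product, Finset.mem_range, Finset.mem_range]
    exact ⟨fun h => absurd (T.injective h) (ne_of_lt hjk), by omega, by omega⟩
  · intro x hx
    have hx' := Finset.mem_coe.1 hx
    rw [Finset.mem_erase, Finset.mem_product, Finset.mem_range, Finset.mem_range] at hx'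
    obtain ⟨hne, hx1, hx2⟩ := hx'
    have hle : x ≤ T.1 k := Prod.le_def.2 ⟨by omega, by omega⟩
    have hxμ : x ∈ μ.youngDiagram := μ.youngDiagram.isLowerSet hle (T.mem k)
    obtain ⟨j, hj⟩ := T.exists_eq μ.card_cells_youngDiagram hxμ
    have hlt : j < k := by
      rcases lt_trichotomy j k with h | rfl | h
      · exact h
      · exact absurd hj.symm hne
      · exact absurd (hj ▸ hle) (T.not_le h)
    exact ⟨j, Finset.mem_coe.2 (Finset.mem_filter.2 ⟨Finset.mem_univ _, hlt, hj ▸ hle⟩), hj⟩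

/-- **The entry-wise identity.** For each entry `k` with cell `(r, c)`:
`[u_k > 0] π_k − Σ_{j < k} κ(u_k − u_j) π_j π_k = 2 [c odd] − 4 Σ_{j < k, cell j strictly SW of (r, c)} π_j π_k`.
[folklore] -/
private theorem swPairs_entry (κ : ℤ → ℤ) (h2 : ∀ d, 2 ≤ d → κ d = 4) (h1 : κ 1 = 3)
    (h0 : κ 0 = 1) (hn : ∀ d, d < 0 → κ d = 0) {n : ℕ} {μ : Nat.Partition n}
    (T : StdFilling n μ.youngDiagram) (k : Fin n) :
    (if (0 : ℤ) < ((T.1 k).2 : ℤ) - (T.1 k).1 then (-1 : ℤ) ^ ((T.1 k).1 + (T.1 k).2) else 0) -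
        ∑ j ∈ Finset.univ.filter (fun j : Fin n => j < k),
          κ ((((T.1 k).2 : ℤ) - (T.1 k).1) - (((T.1 j).2 : ℤ) - (T.1 j).1)) *
            (-1 : ℤ) ^ ((T.1 j).1 + (T.1 j).2 + (T.1 k).1 + (T.1 k).2) =
      (if (T.1 k).2 % 2 = 1 then (2 : ℤ) else 0) -
        4 * ∑ j ∈ Finset.univ.filter (fun j : Fin n =>
              j < k ∧ (T.1 k).1 < (T.1 j).1 ∧ (T.1 j).2 < (T.1 k).2),
            (-1 : ℤ) ^ ((T.1 j).1 + (T.1 j).2 + (T.1 k).1 + (T.1 k).2) := by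
  -- the weakly-north-west part of the pair sum is the rectangle sum minus its diagonal term `1`
  have hNW := swPairs_sum_nw T k (fun x : ℕ × ℕ =>
    κ ((((T.1 k).2 : ℤ) - (T.1 k).1) - ((x.2 : ℤ) - x.1)) *
      (-1 : ℤ) ^ (x.1 + x.2 + (T.1 k).1 + (T.1 k).2))
  beta_reduce at hNW
  have hsq : (-1 : ℤ) ^ ((T.1 k).1 + (T.1 k).2 + (T.1 k).1 + (T.1 k).2) = 1 :=
    Even.neg_one_pow ⟨(T.1 k).1 + (T.1 k).2, by ring⟩
  rw [Finset.sum_filter, Finset.sum_erase_eq_sub (Finset.mem_product.2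
      ⟨Finset.mem_range.2 (Nat.lt_succ_self _), Finset.mem_range.2 (Nat.lt_succ_self _)⟩),
    swPairs_rect κ h2 h1 h0 hn, sub_self, h0, one_mul, hsq] at hNW
  -- split the pair sum according to the position of the cell of `j` relative to the cell of `k`
  rw [Finset.sum_filter, Finset.sum_filter]
  have hkey : ∀ j ∈ (Finset.univ : Finset (Fin n)),
      (if j < k then
          κ ((((T.1 k).2 : ℤ) - (T.1 k).1) - (((T.1 j).2 : ℤ) - (T.1 j).1)) *
            (-1 : ℤ) ^ ((T.1 j).1 + (T.1 j).2 + (T.1 k).1 + (T.1 k).2) else 0) =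
        (if j < k ∧ T.1 j ≤ T.1 k then
            κ ((((T.1 k).2 : ℤ) - (T.1 k).1) - (((T.1 j).2 : ℤ) - (T.1 j).1)) *
              (-1 : ℤ) ^ ((T.1 j).1 + (T.1 j).2 + (T.1 k).1 + (T.1 k).2) else 0) +
          4 * (if j < k ∧ (T.1 k).1 < (T.1 j).1 ∧ (T.1 j).2 < (T.1 k).2 then
            (-1 : ℤ) ^ ((T.1 j).1 + (T.1 j).2 + (T.1 k).1 + (T.1 k).2) else 0) := by
    intro j _
    by_cases hjk : j < k
    · have hkj : ¬ T.1 k ≤ T.1 j := T.not_le hjk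
      rw [Prod.le_def, not_and_or, not_le, not_le] at hkj
      by_cases hle : T.1 j ≤ T.1 k
      · have hle' := Prod.le_def.1 hle
        rw [if_pos hjk, if_pos ⟨hjk, hle⟩, if_neg (fun h => absurd hle'.1 (not_le.2 h.2.1)),
          mul_zero, add_zero]
      · rw [if_pos hjk, if_neg (fun h => hle h.2), zero_add]
        rw [Prod.le_def, not_and_or, not_le, not_le] at hle
        by_cases hsw : (T.1 k).1 < (T.1 j).1 ∧ (T.1 j).2 < (T.1 k).2
        · rw [if_pos ⟨hjk, hsw⟩, h2 _ (by omega)]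
        · rw [if_neg (fun h => hsw h.2), mul_zero]
          rw [not_and_or, not_lt, not_lt] at hsw
          rw [hn _ (by omega), zero_mul]
    · rw [if_neg hjk, if_neg (fun h => hjk h.1), if_neg (fun h => hjk h.1), mul_zero, add_zero]
  rw [Finset.sum_congr rfl hkey, Finset.sum_add_distrib, ← Finset.mul_sum, hNW]
  ring

/-- Summing `2 [c_k odd]` over the entries counts the odd-column cells of the shape twice (a standard
Young tableau is a bijection onto the cells of its shape). [folklore] -/
private theorem swPairs_oddCount {n : ℕ} {μ : Nat.Partition n} (T : StdFilling n μ.youngDiagram) :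
    ∑ k : Fin n, (if (T.1 k).2 % 2 = 1 then (2 : ℤ) else 0) =
      2 * ((μ.youngDiagram.cells.filter (fun c : ℕ × ℕ => c.2 % 2 = 1)).card : ℤ) := by
  rw [Finset.natCast_card_filter, Finset.mul_sum]
  refine Finset.sum_nbij T.1 (fun k _ => (YoungDiagram.mem_cells _).2 (T.mem k))
    T.injective.injOn ?_ ?_
  · intro x hx
    obtain ⟨j, hj⟩ := T.exists_eq μ.card_cells_youngDiagram
      ((YoungDiagram.mem_cells _).1 (Finset.mem_coe.1 hx))
    exact ⟨j, Finset.mem_coe.2 (Finset.mem_univ _), hj⟩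
  · intro k _
    split_ifs <;> norm_num

set_option linter.dupNamespace false in -- deliberate Summit.<S>.<P> duplicate
/-- **Closed form of the `p = 2` Brundan–Kleshchev–Wang degree of a standard Young tableau.**
For `T` standard of shape `μ ⊢ n`, with `π_i = (−1)^(row + col of the cell of i)`:
`deg₂ T = #{cells of μ in odd columns} − 2 Σ_{j < k, cell of j strictly south-west of cell of k} π_j π_k`
("strictly south-west": larger row index and smaller column index).  From the pair-sum formula
`two_mul_tableauDegree_eq_pairSum`: for `j < k` the cell of `j` is weakly north-west of the cell of
`k` (these fill the rectangle spanned by the cell of `k`, whose weighted signed count is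
`1 + [u_k > 0] π_k − 2 [c_k odd]`, `swPairs_rect`), strictly south-west (`κ = 4`) or strictly
north-east (`κ = 0`); the odd-column indicator summed over the entries is the odd-column cell count.
[folklore] -/
theorem deg_eq_oddCols_sub_swPairs : ∀ (n : ℕ) (μ : Nat.Partition n) (T : StdFilling n μ.youngDiagram), tableauDegree 2 T.1 = ((μ.youngDiagram.cells.filter (fun c : ℕ × ℕ => c.2 % 2 = 1)).card : ℤ) - 2 * ∑ k : Fin n, ∑ j ∈ Finset.univ.filter (fun j : Fin n => j < k ∧ (T.1 k).1 < (T.1 j).1 ∧ (T.1 j).2 < (T.1 k).2), (-1 : ℤ) ^ ((T.1 j).1 + (T.1 j).2 + (T.1 k).1 + (T.1 k).2) := by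
  intro n μ T
  have hpair := two_mul_tableauDegree_eq_pairSum n μ T
  have hentry := fun k : Fin n => swPairs_entry
    (fun d : ℤ => if 2 ≤ d then (4 : ℤ) else if d = 1 then 3 else if d = 0 then 1 else 0)
    (fun d hd => if_pos hd) (by norm_num) (by norm_num)
    (fun d hd => by
      show (if 2 ≤ d then (4 : ℤ) else if d = 1 then 3 else if d = 0 then 1 else 0) = 0
      rw [if_neg (by omega), if_neg (by omega), if_neg (by omega)]) T k
  beta_reduce at hentry
  rw [Finset.sum_congr rfl fun k _ => hentry k, Finset.sum_sub_distrib, ← Finset.mul_sum,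
    swPairs_oddCount T] at hpair
  omega

end Summit.MatrixMultiplication.MatrixMultiplication.Theorems
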